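import Literature.AlgebraicGeometry.HodgeTheory.VertexBlowupConeHost
import Literature.AlgebraicGeometry.HodgeTheory.FermatConeSpanOfConeCoordinates
import Literature.AlgebraicGeometry.Motives.ProjectiveSpaceLinearMapsPoints
import Literature.AlgebraicGeometry.Motives.ProjectiveSpaceLinearMapsClosedImmersion
import Literature.AlgebraicGeometry.Motives.AbelianVarietyIdentityComponent
import Literature.AlgebraicGeometry.Motives.AlgPointsNonempty
import HarnessLib

/-!
# The cone-span leaf (III-l) of Aoki's Thm. 1-4 (i): the cone over a sub-Fermat variety, constructed — `Shioda1979_coneSpan_represents_left` holds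

Family `hodge`, layer `Literature/AlgebraicGeometry/HodgeTheory`. PROOF FILE (theorems only; no
definition, no named fact; one named fact DISCHARGED). N. Aoki, *Some new algebraic cycles on Fermat
varieties*, J. Math. Soc. Japan 39 (1987), Thm. 1-4 (i) with `r = 0` (p. 388; "represents ⟹ claim",
p. 386): for Hodge characters `α = (c, -c)` of `X⁰ₘ` and `β` of `X²ˢₘ`, the CONE over a cycle of
`X²ˢₘ` with vertex a point of `X⁰ₘ` realises `α ∗ β` on `X^{2s+2}ₘ` (Z. Ran, Compositio Math. 42 (1980),
§4 p. 138: the lines joining `X⁰ₘ × X²ˢₘ ⊂ X^{2s+2}ₘ` lie on `X`; T. Shioda, Math. Ann. 245 (1979),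
Thm. I; G. da Silva Jr., arXiv:2101.04739, Thm. 2.2 (b)). The tree had reduced this leaf — the named
fact `Shioda1979_coneSpan_represents_left` of `HodgeTheory/FermatJuxtapositionSpans` — to a pure
scheme construction, the CONE-COORDINATES DATUM of
`Shioda1979_coneSpan_represents_left_of_coneCoordinates` (`HodgeTheory/FermatConeSpanOfConeCoordinates`):
a smooth projective `(2s+1)`-fold `E`, a flat `π : E → X²ˢₘ` with closed-immersion section `σ`, and
`φ : E → X^{2(0+s+1)}ₘ` with (base) `σ ≫ φ = ([z] ↦ [0 : 0 : z])`, (cone) `x₀ ≠ 0`, `x₁ = ε x₀` off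
`σ`, (h1') `φ_* 1 ≠ 0`. This file BUILDS the datum and discharges the fact:

* `E = T ×_{ℙ^{2s+1}} X²ˢₘ`, the projective cone over `X²ˢₘ ⊂ ℙ^{2s+1}` with vertex
  `p = (0 : … : 0 : 1) ∈ ℙ^{2s+2}` blown up at `p`, realised inside the vertex blow-up
  `T = Bl_p ℙ^{2s+2} → ℙ^{2s+1}` of de Jong's Lemma 4.11 (`exists_coneHost`,
  `HodgeTheory/VertexBlowupConeHost`; `= ℙ(𝒪 ⊕ 𝒪(1))` over `X²ˢₘ`);
* `φ = ` blow-down `E → ℙ^{2s+2}` followed by the linear closed immersion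
  `[u₀ : ⋯ : u_{2s+1} : u_{2s+2}] ↦ [u_{2s+2} : ε u_{2s+2} : u₀ : ⋯ : u_{2s+1}]`, `ε = e^{πi/m}`
  (`ProjectiveSpace.linSubstMap`), factored through `X = V₊(Σ xᵢᵐ)` since
  `x₀ᵐ + x₁ᵐ = u_{2s+2}ᵐ (1 + εᵐ) = 0` on the cone (`Motives.liftOfRangeSubset`, the containment
  checked on complex points by `SchemeOver.range_subset_of_forall_algPoints`);
* `exists_fermatConeCoordinates` — **the datum, for all `m, s ≥ 1`**;
* `Shioda1979_coneSpan_represents_left_holds` — **the leaf (III-l) holds.**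

Downstream (all already in the tree, CONDITIONAL on this fact until now): claim(`(c,-c) ∗ β`) on the
Fermat fourfold for `β ∈ 𝔅²ₘ` (`FermatCharacter.claim_cone_surface_of_coneSpan`), the four type-`1`
eigenlines of the Fermat sextic fourfold (`fermatSextic_claims_typeOne_of_coneSpan`), and the crux
`FlatClassesSpannedByReflectionInvariants` / child `TypeOneHodge` of the route
`DworkReflectionQuotients` of `Summits/HodgeConjecture` (`…_of_coneSpan`).

## References

* [Aoki1987] N. Aoki, Some new algebraic cycles on Fermat varieties, J. Math. Soc. Japan 39 (1987)
  385–396: Thm. 1-4 (i) p. 388, p. 386.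
* [Ran1980] Z. Ran, Cycles on Fermat hypersurfaces, Compositio Math. 42 (1980), §4 p. 138, Prop. 1.14.
* [Shioda1979HodgeFermat] T. Shioda, The Hodge conjecture for Fermat varieties, Math. Ann. 245 (1979)
  175–184, Thm. I.
* [daSilva2021HodgeFermat] G. da Silva Jr., Notes on the Hodge Conjecture for Fermat Varieties,
  arXiv:2101.04739, Thm. 2.2 (b).
* [EisenbudHarris2016] D. Eisenbud, J. Harris, 3264 and All That, §9.3.2 (the blow-up of `ℙⁿ` in a
  point as a `ℙ¹`-bundle).
* [Hartshorne1977] R. Hartshorne, Algebraic Geometry, II Ex. 2.14, II Thm. 7.1, II Ex. 3.11 (d).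
-/

noncomputable section

open CategoryTheory CategoryTheory.Limits AlgebraicGeometry Finset
open Literature.AlgebraicGeometry.Motives Literature.AlgebraicGeometry.Resolution
open Literature.AlgebraicTopology.SingularHomology

namespace Literature.AlgebraicGeometry.HodgeTheory

section HodgeTheory

/-! ### Index bookkeeping for the two coordinate blocks of `X^{2(0+s+1)}ₘ` -/

/-- Splitting a sum over the coordinates of `X^{2(0+s+1)}ₘ` into the two blocks. [folklore] -/
private theorem sum_eq_sum_embFirst_add_sum_embSecond {M : Type*} [AddCommMonoid M] (s : ℕ)
    (g : Fin (2 * (0 + s + 1) + 2) → M) :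
    ∑ i, g i = ∑ a, g (FermatCharacter.embFirst 0 s a) + ∑ j, g (FermatCharacter.embSecond 0 s j) := by
  rw [← Equiv.sum_comp (finCongr (FermatCharacter.two_mul_add_two 0 s)).symm, Fin.sum_univ_add]
  rfl

/-- `Fin.append a b` read through the cast on the first block. [folklore] -/
private theorem append_finCongr_embFirst {M : Type*} (s : ℕ) (a : Fin (2 * 0 + 2) → M) (b : Fin (2 * s + 2) → M)
    (i : Fin (2 * 0 + 2)) :
    Fin.append a b (finCongr (FermatCharacter.two_mul_add_two 0 s) (FermatCharacter.embFirst 0 s i)) = a i := by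
  simp [FermatCharacter.embFirst]

/-- `Fin.append a b` read through the cast on the second block. [folklore] -/
private theorem append_finCongr_embSecond {M : Type*} (s : ℕ) (a : Fin (2 * 0 + 2) → M) (b : Fin (2 * s + 2) → M)
    (j : Fin (2 * s + 2)) :
    Fin.append a b (finCongr (FermatCharacter.two_mul_add_two 0 s) (FermatCharacter.embSecond 0 s j)) = b j := by
  simp [FermatCharacter.embSecond]

/-! ### The cone-coordinates datum -/

open FermatCharacter (embFirst embSecond) in
/-- **The cone-coordinates datum of the leaf (III-l), for all `m ≥ 1`, `s ≥ 1`.** There are a smooth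
projective `(2s+1)`-fold `E`, a flat `π : E → X²ˢₘ` with a closed-immersion section `σ`, and
`φ : E → X^{2(0+s+1)}ₘ` with (base) `σ ≫ φ = ι_S`, the sub-Fermat embedding `[z] ↦ [0 : 0 : z]`
(`fermatEmb (embSecond 0 s)`), (cone) every complex point off `σ` mapping to `[x]` with `x₀ ≠ 0`,
`x₁ = ε x₀`, `εᵐ = -1`, and (h1') `φ_* 1 ≠ 0`. CONSTRUCTION: `E = T ×_{ℙ^{2s+1}} X²ˢₘ` is the blown-up
cone over `X²ˢₘ` in the vertex blow-up `T` of `ℙ^{2s+2}` (`exists_coneHost`), and `φ` is the blow-down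
`E → ℙ^{2s+2}` followed by the linear map `[u₀ : ⋯ : u_{2s+1} : u_{2s+2}] ↦ [u_{2s+2} : ε u_{2s+2} : u₀ :
⋯ : u_{2s+1}]` (`ProjectiveSpace.linSubstMap`, a closed immersion), which carries the cone
`{Σ_{j ≤ 2s+1} u_jᵐ = 0}` into `X^{2s+2}ₘ ∩ {x₁ = ε x₀}` because `x₀ᵐ + x₁ᵐ = u_{2s+2}ᵐ (1 + εᵐ) = 0`;
the factorisation through `X = V₊(Σ xᵢᵐ)` is checked on complex points
(`SchemeOver.range_subset_of_forall_algPoints`, `Motives.liftOfRangeSubset`), (base) on complex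
points (`SchemeOver.hom_ext_of_forall_algPoints`), and (h1') by
`complexGysin_one_ne_zero_of_stalkMap_surjective` at a point of `σ`. In print: the cone
`X ∩ {x₁ = ε x₀}` over `X²ˢₘ = X ∩ {x₀ = x₁ = 0}` with vertex `(1 : ε : 0 : ⋯ : 0)`, blown up at the
vertex (Aoki 1987, Thm. 1-4 (i) with `r = 0`; Ran 1980 §4; Shioda 1979 Thm. I; da Silva Thm. 2.2 (b)).
[cite: Aoki1987, Thm. 1-4 (i) p. 388 and p. 386] [cite: Ran1980, §4 p. 138]
[cite: daSilva2021HodgeFermat, Thm. 2.2 (b)] -/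
theorem exists_fermatConeCoordinates (m s : ℕ) [NeZero m] (hs : 1 ≤ s) :
    ∃ (E : SchemeOver ℂ) (hE : IsSmoothProjective (2 * s + 1) E)
      (π : E ⟶ fermatHypersurface (2 * s) m) (_ : Flat π.left)
      (σ : fermatHypersurface (2 * s) m ⟶ E) (_ : σ ≫ π = 𝟙 _) (_ : IsClosedImmersion σ.left)
      (φ : E ⟶ fermatHypersurface (2 * (0 + s + 1)) m) (_ : σ ≫ φ = fermatEmb (embSecond 0 s) NeZero.one_le)
      (ε : ℂ) (_ : ε ≠ 0),
      (∀ P : ComplexPoints E, P ∉ Set.range (AlgPoints.map σ) →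
        (hypersurfacePoint (SmoothHypersurface.hypersurfaceι (fermatPolynomial ℂ (2 * (0 + s + 1)) m))
            (AlgPoints.map φ P)).rep (embFirst 0 s 0) ≠ 0 ∧
        (hypersurfacePoint (SmoothHypersurface.hypersurfaceι (fermatPolynomial ℂ (2 * (0 + s + 1)) m))
            (AlgPoints.map φ P)).rep (embFirst 0 s 1) =
          ε * (hypersurfacePoint (SmoothHypersurface.hypersurfaceι (fermatPolynomial ℂ (2 * (0 + s + 1)) m))
            (AlgPoints.map φ P)).rep (embFirst 0 s 0)) ∧
      complexGysin complexOrientationFamily hE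
        (isSmoothProjective_fermatHypersurface (n := 2 * (0 + s + 1)) (by omega) NeZero.one_le) φ
        (show 0 + 2 * (2 * (0 + s + 1)) = 2 + 2 * (2 * s + 1) by omega)
        (singularCohomology.one ℂ (ComplexPoints E)) ≠ 0 := by
  have hm : 1 ≤ m := NeZero.one_le
  have hm0 : m ≠ 0 := NeZero.ne m
  -- the two Fermat varieties
  set FS := fermatPolynomial ℂ (2 * s) m with hFS
  set FX := fermatPolynomial ℂ (2 * (0 + s + 1)) m with hFX
  set ιS := SmoothHypersurface.hypersurfaceι FS with hιS
  set ιX := SmoothHypersurface.hypersurfaceι FX with hιX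
  have hS : IsSmoothProjective (2 * s) (fermatHypersurface (2 * s) m) :=
    isSmoothProjective_fermatHypersurface (by omega) hm
  have hX : IsSmoothProjective (2 * (0 + s + 1)) (fermatHypersurface (2 * (0 + s + 1)) m) :=
    isSmoothProjective_fermatHypersurface (n := 2 * (0 + s + 1)) (by omega) NeZero.one_le
  haveI : LocallyOfFiniteType (fermatHypersurface (2 * s) m).hom := locallyOfFiniteType_of_isSmoothProjective hS
  haveI : IsIntegral (fermatHypersurface (2 * s) m).left := IsSmoothProjective.isIntegral_holds hS
  haveI : IsProper (fermatHypersurface (2 * (0 + s + 1)) m).hom := IsSmoothProjective.isProper_holds hX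
  -- the root of `-1`
  set ε : ℂ := Complex.exp (Real.pi * Complex.I / m) with hεdef
  have hε : ε ≠ 0 := Complex.exp_ne_zero _
  have hεm : ε ^ m = -1 := by
    rw [hεdef, ← Complex.exp_nat_mul, mul_div_cancel₀ _ (Nat.cast_ne_zero.2 hm0), Complex.exp_pi_mul_I]
  -- the cone host
  obtain ⟨E, hE, π, hflat, σ, hσπ, hσcl, φ₀, hbase, hpts, hst⟩ := exists_coneHost hS ιS
  haveI : IsIntegral E.left := IsSmoothProjective.isIntegral_holds hE
  haveI : LocallyOfFiniteType E.hom := locallyOfFiniteType_of_isSmoothProjective hE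
  -- the linear substitution `x₀ ↦ u_last, x₁ ↦ ε u_last, x_{2+j} ↦ u_j`
  let av : Fin (2 * 0 + 2) → MvPolynomial (Fin (2 * s + 1 + 1 + 1)) ℂ :=
    ![MvPolynomial.X (Fin.last _), MvPolynomial.C ε * MvPolynomial.X (Fin.last _)]
  let bv : Fin (2 * s + 2) → MvPolynomial (Fin (2 * s + 1 + 1 + 1)) ℂ :=
    fun j ↦ MvPolynomial.X (Fin.castSucc j)
  let τ : Fin (2 * (0 + s + 1) + 2) → MvPolynomial (Fin (2 * s + 1 + 1 + 1)) ℂ :=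
    fun i ↦ Fin.append av bv (finCongr (FermatCharacter.two_mul_add_two 0 s) i)
  have hτ0 : τ (embFirst 0 s 0) = MvPolynomial.X (Fin.last _) := append_finCongr_embFirst s av bv 0
  have hτ1 : τ (embFirst 0 s 1) = MvPolynomial.C ε * MvPolynomial.X (Fin.last _) :=
    append_finCongr_embFirst s av bv 1
  have hτ2 : ∀ j, τ (embSecond 0 s j) = MvPolynomial.X (Fin.castSucc j) :=
    fun j ↦ append_finCongr_embSecond s av bv j
  have hτ : ∀ i, (τ i).IsHomogeneous 1 := by
    intro i
    rcases FermatCharacter.embFirst_or_embSecond i with ⟨a, rfl⟩ | ⟨j, rfl⟩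
    · fin_cases a
      · rw [show ((⟨0, by omega⟩ : Fin (2 * 0 + 2))) = 0 from rfl, hτ0]
        exact MvPolynomial.isHomogeneous_X ℂ _
      · rw [show ((⟨1, by omega⟩ : Fin (2 * 0 + 2))) = 1 from rfl, hτ1]
        exact (MvPolynomial.isHomogeneous_X ℂ _).C_mul ε
    · rw [hτ2]
      exact MvPolynomial.isHomogeneous_X ℂ _
  have hgen : ∀ j : Fin (2 * s + 1 + 1 + 1), ∃ i, τ i = MvPolynomial.X j := by
    intro j
    induction j using Fin.lastCases with
    | last => exact ⟨embFirst 0 s 0, hτ0⟩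
    | cast j => exact ⟨embSecond 0 s j, hτ2 j⟩
  -- evaluating the substitution
  have hev : ∀ (w : Fin (2 * s + 1 + 1 + 1) → ℂ),
      MvPolynomial.aeval w (τ (embFirst 0 s 0)) = w (Fin.last _) ∧
      MvPolynomial.aeval w (τ (embFirst 0 s 1)) = ε * w (Fin.last _) ∧
      ∀ j, MvPolynomial.aeval w (τ (embSecond 0 s j)) = w (Fin.castSucc j) := by
    intro w
    refine ⟨?_, ?_, fun j ↦ ?_⟩
    · rw [hτ0, MvPolynomial.aeval_X]
    · rw [hτ1, map_mul, MvPolynomial.aeval_C, MvPolynomial.aeval_X, Algebra.algebraMap_self,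
        RingHom.id_apply]
    · rw [hτ2, MvPolynomial.aeval_X]
  have hFev : ∀ (w : Fin (2 * s + 1 + 1 + 1) → ℂ),
      MvPolynomial.aeval (fun i ↦ MvPolynomial.aeval w (τ i)) FX =
        MvPolynomial.aeval (w ∘ Fin.castSucc) FS := by
    intro w
    obtain ⟨h0, h1, h2⟩ := hev w
    rw [hFX, hFS, fermatPolynomial, fermatPolynomial, map_sum, map_sum,
      sum_eq_sum_embFirst_add_sum_embSecond]
    simp only [map_pow, MvPolynomial.aeval_X, Function.comp_apply]
    rw [Fin.sum_univ_two]
    change MvPolynomial.aeval w (τ (embFirst 0 s 0)) ^ m + MvPolynomial.aeval w (τ (embFirst 0 s 1)) ^ m +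
      ∑ j, MvPolynomial.aeval w (τ (embSecond 0 s j)) ^ m = _
    rw [h0, h1]
    simp_rw [h2]
    rw [mul_pow, hεm]
    ring
  -- the linear map `L : ℙ^{2s+2} → ℙ^{2s+3}` and `φ' = φ₀ ≫ L`
  let L := ProjectiveSpace.linSubstMap τ hτ hgen
  haveI : IsClosedImmersion L.left := ProjectiveSpace.isClosedImmersion_linSubstMap_left τ hτ hgen
  let φ' : E ⟶ projectiveSpace (2 * (0 + s + 1) + 1) ℂ := φ₀ ≫ L
  have hφ'pt : ∀ (e : ComplexPoints E) (u : Fin (2 * s + 1 + 1 + 1) → ℂ) (hu : u ≠ 0),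
      AlgPoints.map φ₀ e = ProjectiveSpace.pointOfVec ℂ u hu →
      AlgPoints.map φ' e = ProjectiveSpace.pointOfVec ℂ (fun i ↦ MvPolynomial.aeval u (τ i))
        (ProjectiveSpace.linSubstVec_ne_zero τ hgen hu) := by
    intro e u hu he
    change AlgPoints.map (φ₀ ≫ L) e = _
    rw [AlgPoints.map_comp_apply, he, AlgPoints.map_apply, ProjectiveSpace.pointOfVec_comp_linSubstMap]
  -- `φ'` lands in `X = V₊(FX)` (checked on complex points)
  have hrange : Set.range φ'.left.base ⊆ Set.range ιX.left.base := by
    refine SchemeOver.range_subset_of_forall_algPoints φ'.left ιX.left.isClosedEmbedding.isClosed_range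
      fun e ↦ ?_
    obtain ⟨u, hu, hφe, hor, -⟩ := hpts e
    change (AlgPoints.map φ' e).pt ∈ Set.range ιX.left.base
    rw [hφ'pt e u hu hφe, hιX,
      SmoothHypersurface.pt_pointOfVec_mem_range_hypersurfaceι_iff FX (isHomogeneous_fermatPolynomial _ _)
        (Nat.pos_of_ne_zero hm0), hFev]
    rcases hor with hz | ⟨hz, hιe⟩
    · rw [hz, hFS, fermatPolynomial, map_sum]
      simp [zero_pow hm0]
    · rw [← SmoothHypersurface.pt_pointOfVec_mem_range_hypersurfaceι_iff FS
        (isHomogeneous_fermatPolynomial _ _) (Nat.pos_of_ne_zero hm0) _ hz, ← hιe]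
      exact AlgPoints.pt_map_mem_range _ _
  let φ : E ⟶ fermatHypersurface (2 * (0 + s + 1)) m :=
    Over.homMk (liftOfRangeSubset ιX.left φ'.left hrange) (by
      rw [← Over.w ιX, liftOfRangeSubset_comp_assoc, Over.w φ'])
  have hφι : φ ≫ ιX = φ' := by
    ext : 1
    exact liftOfRangeSubset_comp _ _ hrange
  -- evaluating the substitution at `(y : 0)`: the sub-Fermat embedding `[z] ↦ [0 : 0 : z]`
  have hext : ∀ y : Fin (2 * s + 1 + 1) → ℂ,
      (fun i ↦ MvPolynomial.aeval (ProjectiveSpace.insertZero (Fin.last (2 * s + 1 + 1)) y) (τ i)) =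
        extendVec (embSecond 0 s) y := by
    intro y
    obtain ⟨h0, h1, h2⟩ := hev (ProjectiveSpace.insertZero (Fin.last (2 * s + 1 + 1)) y)
    funext i
    rcases FermatCharacter.embFirst_or_embSecond i with ⟨a, rfl⟩ | ⟨j, rfl⟩
    · have hne : embFirst 0 s a ∉ Set.range (embSecond 0 s) := by
        rintro ⟨k, hk⟩
        exact FermatCharacter.embFirst_ne_embSecond a k hk.symm
      rw [extendVec_apply_of_not_mem_range _ _ hne]
      fin_cases a
      · rw [show ((⟨0, by omega⟩ : Fin (2 * 0 + 2))) = 0 from rfl, h0, ProjectiveSpace.insertZero_self]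
      · rw [show ((⟨1, by omega⟩ : Fin (2 * 0 + 2))) = 1 from rfl, h1, ProjectiveSpace.insertZero_self,
          mul_zero]
    · rw [h2, extendVec_apply_emb, ← Fin.succAbove_last, ProjectiveSpace.insertZero_succAbove]
  -- (base): `σ ≫ φ` is the sub-Fermat embedding, checked on complex points
  have hbase' : σ ≫ φ = fermatEmb (embSecond 0 s) NeZero.one_le := by
    refine SchemeOver.hom_ext_of_forall_algPoints ℂ fun R ↦ ?_
    change AlgPoints.map (σ ≫ φ) R = AlgPoints.map (fermatEmb (embSecond 0 s) NeZero.one_le) R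
    apply AlgPoints.map_injective_of_mono ιX
    obtain ⟨y, hy, hR⟩ := ProjectiveSpace.exists_eq_pointOfVec (AlgPoints.map ιS R)
    have h1 : AlgPoints.map ιX (AlgPoints.map (σ ≫ φ) R) =
        ProjectiveSpace.pointOfVec ℂ (extendVec (embSecond 0 s) y) (extendVec_ne_zero _ hy) := by
      rw [← AlgPoints.map_comp_apply, Category.assoc, hφι, AlgPoints.map_comp_apply]
      have h0 : AlgPoints.map φ₀ (AlgPoints.map σ R) =
          ProjectiveSpace.pointOfVec ℂ (ProjectiveSpace.insertZero (Fin.last (2 * s + 1 + 1)) y)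
            (ProjectiveSpace.insertZero_ne_zero _ hy) := by
        rw [← AlgPoints.map_comp_apply, hbase, AlgPoints.map_comp_apply, hR, AlgPoints.map_apply,
          ProjectiveSpace.pointOfVec_comp_skipMap]
      rw [hφ'pt _ _ _ h0]
      simp_rw [hext y]
    have h2 : AlgPoints.map ιX (AlgPoints.map (fermatEmb (embSecond 0 s) NeZero.one_le) R) =
        ProjectiveSpace.pointOfVec ℂ (extendVec (embSecond 0 s) y) (extendVec_ne_zero _ hy) := by
      rw [← AlgPoints.map_comp_apply, fermatEmb, hypersurfaceCoordEmb_comp_ι, AlgPoints.map_comp_apply,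
        ← hιS, hR, ← projPoint_mk_eq_pointOfVec, map_coordProjEmb_projPoint, projPoint_mk_eq_pointOfVec]
    rw [h1, h2]
  -- a complex point of `S`
  obtain ⟨R₀⟩ := (inferInstance : Nonempty (ComplexPoints (fermatHypersurface (2 * s) m)))
  -- (h1'): `φ` is onto on the stalk at `σ(R₀)`
  have hsurj : Function.Surjective (φ.left.stalkMap (AlgPoints.map σ R₀).pt) := by
    have h1 : Function.Surjective (φ'.left.stalkMap (AlgPoints.map σ R₀).pt) := by
      change Function.Surjective ((φ₀ ≫ L).left.stalkMap (AlgPoints.map σ R₀).pt)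
      rw [Over.comp_left, Scheme.Hom.stalkMap_comp]
      intro y
      obtain ⟨x₁, rfl⟩ := hst R₀ y
      obtain ⟨x₂, rfl⟩ := L.left.stalkMap_surjective _ x₁
      exact ⟨x₂, rfl⟩
    rw [← hφι, Over.comp_left, Scheme.Hom.stalkMap_comp] at h1
    exact Function.Surjective.of_comp fun y ↦ by
      obtain ⟨x, hx⟩ := h1 y
      exact ⟨_, hx⟩
  have hgys := complexGysin_one_ne_zero_of_stalkMap_surjective complexOrientationFamily hX hE φ
    (AlgPoints.map σ R₀) hsurj (e := 1) (by omega)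
  refine ⟨E, hE, π, hflat, σ, hσπ, hσcl, φ, hbase', ε, hε, ?_, hgys⟩
  -- (cone): off the section, `x₀ = u_last ≠ 0` and `x₁ = ε x₀`
  intro P hP
  obtain ⟨u, hu, hφ₀P, -, hlast⟩ := hpts P
  have hl := hlast hP
  have hpt : hypersurfacePoint ιX (AlgPoints.map φ P) =
      Projectivization.mk ℂ (fun i ↦ MvPolynomial.aeval u (τ i))
        (ProjectiveSpace.linSubstVec_ne_zero τ hgen hu) := by
    refine hypersurfacePoint_eq_of_projPoint_eq ιX _ ?_
    rw [projPoint_mk_eq_pointOfVec, ← hφ'pt P u hu hφ₀P, ← hφι, AlgPoints.map_comp_apply]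
  obtain ⟨c, hc⟩ := Projectivization.exists_smul_eq_mk_rep ℂ (fun i ↦ MvPolynomial.aeval u (τ i))
    (ProjectiveSpace.linSubstVec_ne_zero τ hgen hu)
  obtain ⟨h0, h1, -⟩ := hev u
  rw [hιX] at hpt
  rw [hpt, ← hc, Pi.smul_apply, Pi.smul_apply, h0, h1]
  refine ⟨?_, ?_⟩
  · rw [Units.smul_def]
    exact smul_ne_zero (Units.ne_zero c) hl
  · simp only [Units.smul_def, smul_eq_mul]
    ring


/-- **The cone-span leaf (III-l) of Aoki's Thm. 1-4 (i) — the named fact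
`Shioda1979_coneSpan_represents_left` (`HodgeTheory/FermatJuxtapositionSpans`) — DISCHARGED**: for all
`m, s ≥ 1`, every Hodge character `α` of `X⁰ₘ` and `β ∈ 𝔅²ˢₘ`, the completed cone over `X²ˢₘ` with
vertex a point of `X⁰ₘ` is a span `X²ˢₘ ←π— E —φ→ X^{2(0+s+1)}ₘ` whose push–pull of some `w ∈ V(β)` has
non-zero `(α ∗ β)`-component: the cone-coordinates datum `exists_fermatConeCoordinates` fed into
`Shioda1979_coneSpan_represents_left_of_coneCoordinates` (`HodgeTheory/FermatConeSpanOfConeCoordinates`,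
which carries all the cohomology: stabiliser averaging, clean base change of Gysin maps, self-term
elimination, `φ_* 1 ≠ 0 ⟹ φ^*φ_* 1 ≠ 0`). Consumers: `FermatCharacter.claim_cone_surface_of_coneSpan`
(claim(`(c,-c) ∗ β`) on `X⁴ₘ`), the four type-`1` claims of the Fermat sextic fourfold
(`fermatSextic_claims_typeOne_of_coneSpan`), `FermatCharacter.Claim.append_of_coneSpan_represents_left`.
[cite: Aoki1987, Thm. 1-4 (i) p. 388 and p. 386] [cite: Shioda1979HodgeFermat, Thm. I]
[cite: Ran1980, §4 p. 138 and Prop. 1.14] [cite: daSilva2021HodgeFermat, Thm. 2.2 (b)] -/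
theorem Shioda1979_coneSpan_represents_left_holds : Shioda1979_coneSpan_represents_left :=
  Shioda1979_coneSpan_represents_left_of_coneCoordinates fun m s _ hs ↦
    exists_fermatConeCoordinates m s hs

end HodgeTheory

end Literature.AlgebraicGeometry.HodgeTheory

end
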